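import Mathlib
import Summits.Ventures.HodgeRepro2.T6N41Euler

/-!
# T6N41Primes — Hecke Euler products over the primes of `E`, regrouped by the places of `F` (pre-M2, carrier-free)

Iwasawa's L-function `L(s; χ)` of a Hecke character of `E` is an Euler product over the PRIME IDEALS of `E`
(`T6N41Hyp.Iwasawa2019_Sec3_1_EulerProductE`: absolutely convergent and unconditionally convergent for `Re s > 1`),
while the doubling L-function and its unramified identity (P3)+(P7) live over the PLACES of `F`: at a place `v` of
`F` the factor `L_v(s, η)` is the product over the (finitely many) primes `𝔓 | v` of `E`.  This file does the
regrouping once, at the level of Mathlib's unconditional products (`HasProd`), and restates the abstract main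
theorem of N4.1 with the Hecke inputs in exactly the printed shape:

* `hasProd_finset_subtype` — the product over a finite set of places;
* `hasProd_fiber_regroup` — `HasProd.sigma` along a fibre map `b : κ → ι` restricted to a set `U ⊆ ι`: an
  unconditional product over `{𝔓 | b 𝔓 ∈ U}` whose fibre products are the `g v` is the product of the `g v`, `v ∈ U`;
* `eulerProduct_split` — `L = (∏_{v ∈ S} g v) · ∏'_{b 𝔓 ∉ S} F 𝔓` and the regrouped tail;
* `factorisation_of_primes` — (P0)+(P3): `Λ = Z · L₁ · L₂` on the half-plane with `Z = L_S · ∏_S g₁⁻¹ g₂⁻¹`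
  (`T6N41Euler.zFun`), from the doubling product as Lapid–Rallis print it («`L = ∏_v L_v`» where it converges);
* `R1_of_eulerProductsE` — `T6N41Euler.R1_of_eulerProducts'` with the Hecke products over the primes of `E`.

Nothing is displayed here (TARGET-T6 §7(c)).  §8(d): uses an L-value-free non-vanishing device: NO.
-/

namespace Summit.Ventures.HodgeRepro2.T6
namespace N41Core

open Summit.Ventures.HodgeRepro2.T5OrderCounting

/-- The (unconditional) product over a finite set of places is the finite product. -/
theorem hasProd_finset_subtype {ι : Type*} (S : Finset ι) (f : ι → ℂ) :
    HasProd (f ∘ Subtype.val : ↥(S : Set ι) → ℂ) (∏ v ∈ S, f v) := by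
  rw [hasProd_subtype_iff_mulIndicator]
  have h : HasProd ((S : Set ι).mulIndicator f) (∏ b ∈ S, (S : Set ι).mulIndicator f b) :=
    hasProd_prod_of_ne_finset_one (fun b hb => Set.mulIndicator_of_notMem (by simpa using hb) f)
  convert h using 1
  exact Finset.prod_congr rfl (fun b hb => (Set.mulIndicator_of_mem (by simpa using hb) f).symm)

/-- **Regrouping along a fibre map.** Let `b : κ → ι` (primes of `E` ↦ places of `F`), `U ⊆ ι`. If the product of
`F` over `{𝔓 | b 𝔓 ∈ U}` converges unconditionally to `P` and, for every `v`, the product of `F` over the fibre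
`{𝔓 | b 𝔓 = v}` converges to `g v`, then the product of the `g v` over `v ∈ U` converges to `P`
(Mathlib's `HasProd.sigma` on `Equiv.sigmaFiberEquiv`). -/
theorem hasProd_fiber_regroup {ι κ : Type*} (b : κ → ι) (F : κ → ℂ) (g : ι → ℂ) (U : Set ι) {P : ℂ}
    (hT : HasProd (fun 𝔓 : {𝔓 // b 𝔓 ∈ U} => F 𝔓) P)
    (hfib : ∀ v, HasProd (fun 𝔓 : {𝔓 // b 𝔓 = v} => F 𝔓) (g v)) :
    HasProd (fun v : U => g v) P := by
  let b' : {𝔓 // b 𝔓 ∈ U} → U := fun 𝔓 => ⟨b 𝔓, 𝔓.2⟩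
  have h1 : HasProd ((fun 𝔓 : {𝔓 // b 𝔓 ∈ U} => F 𝔓) ∘ (Equiv.sigmaFiberEquiv b')) P :=
    (Equiv.hasProd_iff (Equiv.sigmaFiberEquiv b')).2 hT
  refine HasProd.sigma h1 (fun v => ?_)
  let e2 : {x : {𝔓 // b 𝔓 ∈ U} // b' x = v} ≃ {𝔓 // b 𝔓 = v} :=
    { toFun := fun x => ⟨x.1.1, congrArg Subtype.val x.2⟩
      invFun := fun 𝔓 => ⟨⟨𝔓.1, by rw [𝔓.2]; exact v.2⟩, Subtype.ext 𝔓.2⟩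
      left_inv := fun x => by ext; rfl
      right_inv := fun 𝔓 => by ext; rfl }
  have h2 := (Equiv.hasProd_iff e2).2 (hfib v)
  convert h2 using 1
  funext c
  rfl

/-- **Splitting an absolutely convergent Euler product over the primes of `E` at a finite set `S` of places of
`F`.** With `F 𝔓` the factor at the prime `𝔓`, `g v` the fibre product at the place `v`, `L` the value of the
whole product: the tail `∏'_{b 𝔓 ∉ S} F 𝔓` is the unconditional product of the `g v`, `v ∉ S`, and
`L = (∏_{v ∈ S} g v) · ∏'_{b 𝔓 ∉ S} F 𝔓`. -/
theorem eulerProduct_split {ι κ : Type*} (b : κ → ι) (F : κ → ℂ) (g : ι → ℂ) {L : ℂ} (S : Finset ι)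
    (hsum : Summable (fun 𝔓 => F 𝔓 - 1)) (hL : HasProd F L)
    (hfib : ∀ v, HasProd (fun 𝔓 : {𝔓 // b 𝔓 = v} => F 𝔓) (g v)) :
    HasProd (fun v : ↥(S : Set ι)ᶜ => g v) (∏' 𝔓 : ↥(b ⁻¹' (S : Set ι))ᶜ, F 𝔓) ∧
      L = (∏ v ∈ S, g v) * ∏' 𝔓 : ↥(b ⁻¹' (S : Set ι))ᶜ, F 𝔓 := by
  -- the product over `b ⁻¹' S` and over its complement
  have hmulT : Multipliable (F ∘ Subtype.val : ↥(b ⁻¹' (S : Set ι)) → ℂ) :=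
    multipliable_subtype_of_summable_sub_one hsum (fun 𝔓 => 𝔓 ∈ b ⁻¹' (S : Set ι))
  have hmulTc : Multipliable (F ∘ Subtype.val : ↥(b ⁻¹' (S : Set ι))ᶜ → ℂ) :=
    multipliable_subtype_of_summable_sub_one hsum (fun 𝔓 => 𝔓 ∈ (b ⁻¹' (S : Set ι))ᶜ)
  have hsplit : HasProd F ((∏' 𝔓 : ↥(b ⁻¹' (S : Set ι)), F 𝔓) * ∏' 𝔓 : ↥(b ⁻¹' (S : Set ι))ᶜ, F 𝔓) :=
    HasProd.mul_compl hmulT.hasProd hmulTc.hasProd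
  have hLeq : L = (∏' 𝔓 : ↥(b ⁻¹' (S : Set ι)), F 𝔓) * ∏' 𝔓 : ↥(b ⁻¹' (S : Set ι))ᶜ, F 𝔓 :=
    hL.unique hsplit
  -- regroup the finite part
  have hhead : HasProd (fun v : ↥(S : Set ι) => g v) (∏' 𝔓 : ↥(b ⁻¹' (S : Set ι)), F 𝔓) :=
    hasProd_fiber_regroup b F g (S : Set ι) hmulT.hasProd hfib
  have hhead' : ∏' 𝔓 : ↥(b ⁻¹' (S : Set ι)), F 𝔓 = ∏ v ∈ S, g v :=
    hhead.unique (hasProd_finset_subtype S g)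
  -- regroup the tail
  have htail : HasProd (fun v : ↥(S : Set ι)ᶜ => g v) (∏' 𝔓 : ↥(b ⁻¹' (S : Set ι))ᶜ, F 𝔓) :=
    hasProd_fiber_regroup b F g (S : Set ι)ᶜ hmulTc.hasProd hfib
  exact ⟨htail, by rw [hLeq, hhead']⟩

/-- **(P0)+(P3) from the printed Euler products.** The doubling L-function `Λ` is the product of the local factors
`Lv v` wherever that product converges (Lapid–Rallis: «Define `L = ∏_v L_v`»); the Hecke L-functions `L_i` are
absolutely and unconditionally convergent products over the primes `𝔓` of `E` (Iwasawa) whose fibre products at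
the places `v` of `F` are the `g_i v`; off `S`, `Lv v = g₁ v · g₂ v`; on `S` the `g_i v` are non-zero.  Then
`Λ s = Z s · L₁ s · L₂ s` with `Z = zFun S Lv g₁ g₂ = (∏_S Lv) · ∏_S g₁⁻¹ g₂⁻¹`. -/
theorem factorisation_of_primes {ι : Type*} (S : Finset ι) (Lv g₁ g₂ : ι → ℂ → ℂ) (Λ L₁ L₂ : ℂ → ℂ)
    {κ₁ κ₂ : Type*} (b₁ : κ₁ → ι) (b₂ : κ₂ → ι) (F₁ : κ₁ → ℂ → ℂ) (F₂ : κ₂ → ℂ → ℂ) (s : ℂ)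
    (hΛdef : Multipliable (fun v => Lv v s) → Λ s = ∏' v, Lv v s)
    (hfib₁ : ∀ v, HasProd (fun 𝔓 : {𝔓 // b₁ 𝔓 = v} => F₁ 𝔓 s) (g₁ v s))
    (hfib₂ : ∀ v, HasProd (fun 𝔓 : {𝔓 // b₂ 𝔓 = v} => F₂ 𝔓 s) (g₂ v s))
    (h₁e : Summable (fun 𝔓 => F₁ 𝔓 s - 1) ∧ HasProd (fun 𝔓 => F₁ 𝔓 s) (L₁ s))
    (h₂e : Summable (fun 𝔓 => F₂ 𝔓 s - 1) ∧ HasProd (fun 𝔓 => F₂ 𝔓 s) (L₂ s))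
    (hunr : ∀ v ∉ S, Lv v s = g₁ v s * g₂ v s)
    (hg₁ : ∀ v ∈ S, g₁ v s ≠ 0) (hg₂ : ∀ v ∈ S, g₂ v s ≠ 0) :
    Λ s = zFun S Lv g₁ g₂ s * L₁ s * L₂ s := by
  obtain ⟨htail₁, hL₁⟩ := eulerProduct_split b₁ (fun 𝔓 => F₁ 𝔓 s) (fun v => g₁ v s) S h₁e.1 h₁e.2 hfib₁
  obtain ⟨htail₂, hL₂⟩ := eulerProduct_split b₂ (fun 𝔓 => F₂ 𝔓 s) (fun v => g₂ v s) S h₂e.1 h₂e.2 hfib₂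
  set P₁ := ∏' 𝔓 : ↥(b₁ ⁻¹' (S : Set ι))ᶜ, F₁ 𝔓 s with hP₁
  set P₂ := ∏' 𝔓 : ↥(b₂ ⁻¹' (S : Set ι))ᶜ, F₂ 𝔓 s with hP₂
  -- the tail of the doubling product
  have htailΛ : HasProd (fun v : ↥(S : Set ι)ᶜ => Lv v s) (P₁ * P₂) := by
    have hfun : (fun v : ↥(S : Set ι)ᶜ => Lv v s) = fun v : ↥(S : Set ι)ᶜ => g₁ v s * g₂ v s :=
      funext fun v => hunr v v.2
    rw [hfun]
    exact htail₁.mul htail₂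
  have hΛprod : HasProd (fun v => Lv v s) ((∏ v ∈ S, Lv v s) * (P₁ * P₂)) :=
    HasProd.mul_compl (hasProd_finset_subtype S (fun v => Lv v s)) htailΛ
  have hΛs : Λ s = (∏ v ∈ S, Lv v s) * (P₁ * P₂) := by
    rw [hΛdef hΛprod.multipliable, hΛprod.tprod_eq]
  have hne₁ : ∏ v ∈ S, g₁ v s ≠ 0 := Finset.prod_ne_zero_iff.2 hg₁
  have hne₂ : ∏ v ∈ S, g₂ v s ≠ 0 := Finset.prod_ne_zero_iff.2 hg₂
  rw [hΛs, hL₁, hL₂, zFun_apply, Finset.prod_mul_distrib, Finset.prod_inv_distrib,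
    Finset.prod_inv_distrib]
  field_simp

/-- **N4.1 over abstract carriers, with the Hecke L-functions as Iwasawa prints them** (Euler products over the
primes `𝔓` of `E`, indexed by `κ_i` with `b_i : κ_i → ι` the place of `F` below; `g_i v` the fibre products).
Hypotheses: the doubling product as Lapid–Rallis define it (the value wherever it converges) and its meromorphic
continuation; for `i = 1, 2` the fibre products `hfib_i`, the absolute + unconditional convergence of the product
over the primes for `Re s > σ₀` with value `L_i s`, and the meromorphy of `L_i`; the unramified identity off `S`;
the `S`-factors meromorphic of order `≤ 0` at `x`; the removed Hecke fibre factors entire with non-vanishing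
inverses; the Iwasawa dichotomy; holomorphy at `x`.  Conclusion: (R1) and both characters non-trivial. -/
theorem R1_of_eulerProductsE {ι : Type*} (S : Finset ι) (Lv g₁ g₂ : ι → ℂ → ℂ) (Λ L₁ L₂ : ℂ → ℂ)
    {κ₁ κ₂ : Type*} (b₁ : κ₁ → ι) (b₂ : κ₂ → ι) (F₁ : κ₁ → ℂ → ℂ) (F₂ : κ₂ → ℂ → ℂ)
    {σ₀ : ℝ} {x : ℂ} {η₁triv η₂triv : Prop}
    (hΛdef : ∀ s : ℂ, Multipliable (fun v => Lv v s) → Λ s = ∏' v, Lv v s)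
    (hfib₁ : ∀ v (s : ℂ), HasProd (fun 𝔓 : {𝔓 // b₁ 𝔓 = v} => F₁ 𝔓 s) (g₁ v s))
    (hfib₂ : ∀ v (s : ℂ), HasProd (fun 𝔓 : {𝔓 // b₂ 𝔓 = v} => F₂ 𝔓 s) (g₂ v s))
    (h₁e : ∀ s : ℂ, σ₀ < s.re → Summable (fun 𝔓 => F₁ 𝔓 s - 1) ∧ HasProd (fun 𝔓 => F₁ 𝔓 s) (L₁ s))
    (h₂e : ∀ s : ℂ, σ₀ < s.re → Summable (fun 𝔓 => F₂ 𝔓 s - 1) ∧ HasProd (fun 𝔓 => F₂ 𝔓 s) (L₂ s))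
    (hΛm : MeromorphicOn Λ Set.univ) (h₁m : MeromorphicOn L₁ Set.univ)
    (h₂m : MeromorphicOn L₂ Set.univ)
    (hunr : ∀ v ∉ S, ∀ s : ℂ, Lv v s = g₁ v s * g₂ v s)
    (hS : ∀ v ∈ S, MeromorphicOn (Lv v) Set.univ ∧ meromorphicOrderAt (Lv v) x ≤ 0)
    (hg₁ : ∀ v ∈ S, AnalyticOnNhd ℂ (g₁ v)⁻¹ Set.univ ∧ (g₁ v)⁻¹ x ≠ 0 ∧
      ∀ s : ℂ, σ₀ < s.re → g₁ v s ≠ 0)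
    (hg₂ : ∀ v ∈ S, AnalyticOnNhd ℂ (g₂ v)⁻¹ Set.univ ∧ (g₂ v)⁻¹ x ≠ 0 ∧
      ∀ s : ℂ, σ₀ < s.re → g₂ v s ≠ 0)
    (hI₁ : η₁triv → meromorphicOrderAt L₁ x = -1)
    (hI₁' : ¬ η₁triv → AnalyticAt ℂ L₁ x ∧ L₁ x ≠ 0)
    (hI₂ : η₂triv → meromorphicOrderAt L₂ x = -1)
    (hI₂' : ¬ η₂triv → AnalyticAt ℂ L₂ x ∧ L₂ x ≠ 0)
    (hhol : AnalyticAt ℂ Λ x) :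
    (AnalyticAt ℂ Λ x ∧ Λ x ≠ 0) ∧ ¬ η₁triv ∧ ¬ η₂triv ∧
      meromorphicOrderAt (zFun S Lv g₁ g₂) x = 0 := by
  have hZm : MeromorphicOn (zFun S Lv g₁ g₂) Set.univ :=
    meromorphicOn_zFun S Lv g₁ g₂ (fun v hv => (hS v hv).1) (fun v hv => (hg₁ v hv).1)
      (fun v hv => (hg₂ v hv).1)
  have hZ0 : meromorphicOrderAt (zFun S Lv g₁ g₂) x ≤ 0 :=
    meromorphicOrderAt_zFun_le_zero S Lv g₁ g₂ (fun v hv => ⟨(hS v hv).1 x trivial, (hS v hv).2⟩)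
      (fun v hv => ⟨(hg₁ v hv).1 x trivial, (hg₁ v hv).2.1⟩)
      (fun v hv => ⟨(hg₂ v hv).1 x trivial, (hg₂ v hv).2.1⟩)
  have heq : ∀ s : ℂ, σ₀ < s.re → Λ s = zFun S Lv g₁ g₂ s * L₁ s * L₂ s := fun s hs =>
    factorisation_of_primes S Lv g₁ g₂ Λ L₁ L₂ b₁ b₂ F₁ F₂ s (hΛdef s) (fun v => hfib₁ v s)
      (fun v => hfib₂ v s) (h₁e s hs) (h₂e s hs) (fun v hv => hunr v hv s)
      (fun v hv => (hg₁ v hv).2.2 s hs) (fun v hv => (hg₂ v hv).2.2 s hs)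
  obtain ⟨hn₁, hn₂, hne, hZ⟩ :=
    core_of_halfPlane hΛm hZm h₁m h₂m heq hZ0 hI₁ hI₁' hI₂ hI₂' hhol
  exact ⟨⟨hhol, hne⟩, hn₁, hn₂, hZ⟩

end N41Core
end Summit.Ventures.HodgeRepro2.T6
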